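import Literature.Probability.LatticeModels.LeeYangFirstZeroLimitProofs
import Literature.Probability.LatticeModels.PositiveFieldUniqueness
import HarnessLib

/-!
# Analyticity of the free energy in a strip below the first Lee–Yang zeros, and
# `m = ∂f_β/∂h` (Jiang–Newman 2023 / Lee–Yang 1952 / Friedli–Velenik) — proofs

Topic `Probability/LatticeModels`, namespace `Literature.Probability.LatticeModels.JiangNewman`.
Companion PROOF file of `LeeYangFirstZeroLimit.lean` / `LeeYangFirstZeroLimitProofs.lean`
(J. Jiang, C. M. Newman, *Thermodynamic limit of the first Lee–Yang zero*, CPAM 77 (2024)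
1224–1234 [JiangNewman2023]). Theorems only: no definition, no statement and no named fact is
introduced or changed; the named fact `JiangNewman.FirstZeroLimit` is NOT used. Requested by route
`CriticalPhenomena/Ising3DConformalLimit/LeeYangGap` (crux `NearCriticalLeeYangGap`, stub
`stub_edgeAnalyticity`: the magnetisation `h ↦ ⟨σ₀⟩⁺_{β,h}` extends analytically to a strip whose
half-width is comparable to `inf_n α₁(B_n,β)`).

Normalisation (as in the fact file): `Z_{Λ,β,h} = ∑ exp[β∑σσ + h∑σ]` (`partitionFunction`), the
field `h` being Friedli–Velenik's (the tree's) `βh`; `f_{Λ,β} = freeEnergyIn d Λ β`,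
`f_β = freeEnergy d β` (`f_β(h) = ψ(β, h/β)`, `freeEnergy_eq_pressure`), `α₁ = firstZero`.

* `partitionFunction_ne_zero_of_dist_lt` — the zero-free disc about a REAL centre `x`:
  `Z_{Λ,β,z} ≠ 0` for `|z - x| < α₁(Λ,β)` (Lee–Yang off the imaginary axis,
  `partitionFunction_ne_zero_of_re_ne_zero`, and the definition of `α₁` on it).
* `norm_partitionFunction_add_le`, `exists_log_partitionFunction_shift`,
  `exists_taylorCoeff_freeEnergyIn` — `|Z_{Λ,β,x+z}| ≤ e^{|Re z||Λ|} Z_{Λ,β,x}`; the analytic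
  logarithm of `z ↦ Z_{Λ,β,x+z}` on `|z| < α₁`; and the uniform coefficient bound: the Taylor
  coefficients at `x` of `f_{Λ,β}` are bounded by `(2Rr/(R-r)) r^{-k}` for `0 < r < R < α₁(Λ,β)`
  (Borel–Carathéodory on the normalised logarithm, whose real part is `≤ |Re z|`, then Cauchy's
  estimate) — the tree's `abs_magnetizationCumulant_div_card_le` at a general real centre.
* `exists_ball_extension_freeEnergy` — **`f_β` is analytic on the disc of radius `r` about every
  real `x` whenever `r < R < α₁(B_n,β)` for all `n`** (compactness of the coefficient vectors,
  Tannery, clause (0) `tendsto_freeEnergyIn`) — the tree's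
  `analyticOnDisc_of_eventually_lt_firstZero` at a general real centre.
* `exists_strip_extension_of_local` (gluing along the real axis by the identity theorem) and
  `exists_strip_extension_freeEnergy` — **`f_β` extends holomorphically to the strip
  `{|Im z| < w/2}` whenever `0 < w ≤ α₁(B_n,β)` for all `n`.**
* `freeEnergy_sub_le_mul_freeCorr`, `mul_freeCorr_le_freeEnergy_sub`,
  `deriv_freeEnergy_eq_freeCorr`, `deriv_freeEnergy_zero` — the convexity brackets
  `(h₂-h₁)⟨σ₀⟩^∅_{β,h₁/β} ≤ f_β(h₂) - f_β(h₁) ≤ (h₂-h₁)⟨σ₀⟩^∅_{β,h₂/β}` (`0 ≤ h₁ ≤ h₂`; GKS, the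
  free state dominating its boxes, translation invariance; Friedli–Velenik Prop. 3.29), whence
  `f_β'(h) = ⟨σ₀⟩^∅_{β,h/β}` at every `h > 0` where `f_β` is differentiable, and `f_β'(0) = 0`
  (evenness).
* `exists_strip_extension_magnetization` — **for `β > 0` with `m*(β) = 0` and
  `0 < w ≤ α₁(B_n,β)` for all `n`, `h ↦ m(β,h) = ⟨σ₀⟩⁺_{β,h}` (`h ≥ 0`) extends holomorphically to
  `{|Im z| < θ}` whenever `βθ ≤ w/2`** (`F(z) = f_β'(βz)`; `⟨σ₀⟩^∅_{β,h} = ⟨σ₀⟩⁺_{β,h}` for `h > 0`,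
  `freeCorr_eq_plusCorr_singleton_of_pos_holds`).

## References

* [JiangNewman2023] J. Jiang, C. M. Newman, CPAM 77 (2024) 1224–1234, arXiv:2210.03602: Thm. 1,
  §2 eqs. (2.4), (2.24).
* [LeeYang1952] T. D. Lee, C. N. Yang, Phys. Rev. 87 (1952) 410–419, Appendix II.
* [FriedliVelenik2017] S. Friedli, Y. Velenik, *Statistical Mechanics of Lattice Systems*,
  CUP 2017: Thm. 3.6, §3.7 Prop. 3.29 and its proof, Thm. 3.25 (1), Thm. 3.34, Remark 3.41.
-/

noncomputable section

open Filter Topology Finset Complex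

namespace Literature.Probability.LatticeModels

namespace JiangNewman

variable {d : ℕ}

/-! ### Finite volume: the zero-free disc about a real centre and the analytic logarithm -/

/-- **Zero-free disc about a real centre** (Lee–Yang off the imaginary axis, the definition of
`α₁` on it): for `β ≥ 0`, real `x` and `|z - x| < α₁(Λ,β)`, `Z_{Λ,β,z} ≠ 0`.
[cite: LeeYang1952, Appendix II] -/
theorem partitionFunction_ne_zero_of_dist_lt {β : ℝ} (hβ : 0 ≤ β) (Λ : Finset (Site d))
    (x : ℝ) {z : ℂ} (hz : dist z (x : ℂ) < firstZero d Λ β) : partitionFunction d Λ β z ≠ 0 := by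
  by_cases hre : z.re = 0
  · have heq : z = (z.im : ℂ) * I := by
      apply Complex.ext <;> simp [hre]
    rw [heq]
    refine partitionFunction_mul_I_ne_zero_of_abs_lt Λ β (lt_of_le_of_lt ?_ hz)
    have h1 : |(z - (x : ℂ)).im| ≤ ‖z - (x : ℂ)‖ := Complex.abs_im_le_norm _
    rw [dist_eq_norm]
    simpa using h1
  · exact partitionFunction_ne_zero_of_re_ne_zero hβ Λ hre

/-- `|Z_{Λ,β,x+z}| ≤ e^{|Re z| |Λ|} Z_{Λ,β,x}` for real `x`. [folklore] -/
theorem norm_partitionFunction_add_le (Λ : Finset (Site d)) (β x : ℝ) (z : ℂ) :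
    ‖partitionFunction d Λ β ((x : ℂ) + z)‖ ≤
      Real.exp (|z.re| * #Λ) * (partitionFunction d Λ β (x : ℂ)).re := by
  rw [re_partitionFunction_ofReal, partitionFunction, Finset.mul_sum]
  refine (norm_sum_le _ _).trans (Finset.sum_le_sum fun τ _ => ?_)
  rw [Complex.norm_exp, ← Real.exp_add]
  refine Real.exp_le_exp.2 ?_
  set S : ℝ := ∑ e ∈ edgesIn (zdGraph d) Λ, bondSpin (glue Λ τ .free) e with hS
  set M : ℝ := ∑ y ∈ Λ, spinAt y (glue Λ τ .free) with hM
  have hre : ((((β * S : ℝ) : ℂ) + ((x : ℂ) + z) * ((M : ℝ) : ℂ))).re =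
      β * S + x * M + z.re * M := by
    simp [Complex.add_re, Complex.mul_re]
    ring
  rw [hre]
  have h := JiangNewman.abs_sum_spinAt_le Λ (glue Λ τ .free)
  rw [← hM] at h
  have h2 : z.re * M ≤ |z.re| * #Λ :=
    calc z.re * M ≤ |z.re * M| := le_abs_self _
      _ = |z.re| * |M| := abs_mul _ _
      _ ≤ |z.re| * #Λ := mul_le_mul_of_nonneg_left h (abs_nonneg _)
  linarith

/-- **The analytic logarithm of `z ↦ Z_{Λ,β,x+z}` on `|z| < ρ ≤ α₁(Λ,β)`**, normalised by
`ln Z_{Λ,β,x}` at `z = 0` (a primitive of `Z'/Z` on the zero-free disc). [cite: JiangNewman2023, §2 eq. (2.4)] -/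
theorem exists_log_partitionFunction_shift {β : ℝ} (hβ : 0 ≤ β) (Λ : Finset (Site d)) (x : ℝ)
    {ρ : ℝ} (hρ : 0 < ρ) (hρα : ρ ≤ firstZero d Λ β) :
    ∃ L : ℂ → ℂ, DifferentiableOn ℂ L (Metric.ball 0 ρ) ∧
      L 0 = ((Real.log (partitionFunction d Λ β (x : ℂ)).re : ℝ) : ℂ) ∧
      ∀ z ∈ Metric.ball (0 : ℂ) ρ, Complex.exp (L z) = partitionFunction d Λ β ((x : ℂ) + z) := by
  set Z : ℂ → ℂ := fun z => partitionFunction d Λ β ((x : ℂ) + z) with hZ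
  set U : Set ℂ := Metric.ball 0 ρ with hU
  have hUo : IsOpen U := Metric.isOpen_ball
  have hUc : IsPreconnected U := (convex_ball (0 : ℂ) ρ).isPreconnected
  have hZdiff : Differentiable ℂ Z :=
    (differentiable_partitionFunction Λ β).comp ((differentiable_const _).add differentiable_id)
  have hZne : ∀ z ∈ U, Z z ≠ 0 := by
    intro z hz
    refine partitionFunction_ne_zero_of_dist_lt hβ Λ x (lt_of_lt_of_le ?_ hρα)
    have hz' : ‖z‖ < ρ := by simpa [hU] using hz
    simpa [dist_eq_norm] using hz'
  set q : ℂ → ℂ := fun z => deriv Z z / Z z with hq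
  have hZ'diff : Differentiable ℂ (deriv Z) := fun z =>
    ((hZdiff.differentiableOn.analyticOnNhd isOpen_univ).deriv z (Set.mem_univ z)).differentiableAt
  have hqdiff : DifferentiableOn ℂ q U := fun z hz =>
    ((hZ'diff z).differentiableWithinAt).div (hZdiff z).differentiableWithinAt (hZne z hz)
  have hZ0re : 0 < (partitionFunction d Λ β (x : ℂ)).re := partitionFunction_ofReal_re_pos d Λ β x
  set r₀ : ℝ := (partitionFunction d Λ β (x : ℂ)).re with hr₀
  have hZ0 : Z 0 = (r₀ : ℂ) := by
    simp only [hZ, add_zero]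
    exact partitionFunction_ofReal_eq_re Λ β x
  obtain ⟨L, hL0, hL⟩ := (hqdiff.isExactOn_ball).with_val_at 0 ((Real.log r₀ : ℝ) : ℂ)
  have hLdiff : DifferentiableOn ℂ L U := fun z hz =>
    (hL z hz).differentiableAt.differentiableWithinAt
  -- `exp (-L) * Z` is constant `= 1` on the disc
  set φ : ℂ → ℂ := fun z => Complex.exp (-L z) * Z z with hφ
  have hφderiv : ∀ z ∈ U, HasDerivAt φ 0 z := by
    intro z hz
    have h1 : HasDerivAt (fun w => Complex.exp (-L w)) (Complex.exp (-L z) * -q z) z :=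
      (hL z hz).neg.cexp
    have h2 := h1.mul (hZdiff z).hasDerivAt
    refine h2.congr_deriv ?_
    simp only [hq]
    field_simp [hZne z hz]
    ring
  have hφdiff : DifferentiableOn ℂ φ U := fun z hz =>
    (hφderiv z hz).differentiableAt.differentiableWithinAt
  have hφ' : U.EqOn (deriv φ) 0 := fun z hz => (hφderiv z hz).deriv
  have hφ0 : φ 0 = 1 := by
    simp only [hφ]
    rw [hL0, hZ0, ← Complex.ofReal_neg, ← Complex.ofReal_exp, ← Complex.ofReal_mul, Real.exp_neg,
      Real.exp_log hZ0re, inv_mul_cancel₀ hZ0re.ne', Complex.ofReal_one]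
  have hφ1 : ∀ z ∈ U, φ z = 1 := fun z hz =>
    (hUo.is_const_of_deriv_eq_zero hUc hφdiff hφ' hz (Metric.mem_ball_self hρ)).trans hφ0
  have hexp : ∀ z ∈ U, Complex.exp (L z) = Z z := by
    intro z hz
    have h := hφ1 z hz
    simp only [hφ, Complex.exp_neg] at h
    rw [inv_mul_eq_one₀ (Complex.exp_ne_zero _)] at h
    exact h
  exact ⟨L, hLdiff, hL0, hexp⟩

/-- **Uniformly bounded Taylor coefficients about a real centre** (Borel–Carathéodory and Cauchy):
for `β ≥ 0`, nonempty `Λ`, real `x` and `0 < r < R < α₁(Λ,β)` there are real coefficients `e_k`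
with `|e_k| ≤ (2Rr/(R-r)) r^{-k}` and `f_{Λ,β}(x+t) - f_{Λ,β}(x) = ∑_k e_k tᵏ` for real `|t| < r`.
The constants do not depend on `Λ`. [cite: JiangNewman2023, §2 eqs. (2.4), (2.24)] -/
theorem exists_taylorCoeff_freeEnergyIn {β : ℝ} (hβ : 0 ≤ β) {Λ : Finset (Site d)}
    (hΛ : Λ.Nonempty) (x : ℝ) {r R : ℝ} (hr : 0 < r) (hrR : r < R) (hR : R < firstZero d Λ β) :
    ∃ e : ℕ → ℝ, (∀ k, |e k| ≤ (2 * R * r / (R - r)) / r ^ k) ∧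
      ∀ t : ℝ, |t| < r → HasSum (fun k => e k * t ^ k)
        (freeEnergyIn d Λ β (x + t) - freeEnergyIn d Λ β x) := by
  have hR0 : 0 < R := hr.trans hrR
  have hRr : 0 < R - r := sub_pos.2 hrR
  set α := firstZero d Λ β with hα
  have hα0 : 0 < α := hR0.trans hR
  set N : ℝ := (#Λ : ℝ) with hN
  have hNpos : 0 < N := Nat.cast_pos.2 (Finset.card_pos.2 hΛ)
  obtain ⟨L, hL, hL0, hexpL⟩ := exists_log_partitionFunction_shift hβ Λ x hα0 le_rfl
  set U : Set ℂ := Metric.ball (0 : ℂ) α with hU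
  have hZ0pos : 0 < (partitionFunction d Λ β (x : ℂ)).re := partitionFunction_ofReal_re_pos d Λ β x
  -- the normalised logarithm
  set φ : ℂ → ℂ := fun z => (L z - L 0) / (N : ℂ) with hφ
  have hφdiff : DifferentiableOn ℂ φ U := (hL.sub (differentiableOn_const _)).div_const _
  have hφ0 : φ 0 = 0 := by simp [hφ]
  have hreL : ∀ z ∈ U, (L z).re = Real.log ‖partitionFunction d Λ β ((x : ℂ) + z)‖ := by
    intro z hz
    have h := congrArg (fun w => ‖w‖) (hexpL z hz)
    simp only [Complex.norm_exp] at h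
    rw [← h, Real.log_exp]
  -- `Re φ ≤ R` on `|z| < R`
  have hmaps : Set.MapsTo φ (Metric.ball (0 : ℂ) R) {w : ℂ | w.re ≤ R} := by
    intro z hz
    have hzU : z ∈ U := Metric.ball_subset_ball hR.le hz
    have hzR : ‖z‖ < R := by simpa using hz
    have hzα : ‖z‖ < α := by simpa [hU] using hzU
    simp only [Set.mem_setOf_eq, hφ, Complex.div_ofReal_re, Complex.sub_re]
    rw [hreL z hzU, hL0, Complex.ofReal_re, div_le_iff₀ hNpos]
    have hZne : partitionFunction d Λ β ((x : ℂ) + z) ≠ 0 :=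
      partitionFunction_ne_zero_of_dist_lt hβ Λ x (by simpa [dist_eq_norm] using hzα)
    have hZpos : 0 < ‖partitionFunction d Λ β ((x : ℂ) + z)‖ := norm_pos_iff.2 hZne
    have hle := norm_partitionFunction_add_le Λ β x z
    have hlog := Real.log_le_log hZpos hle
    rw [Real.log_mul (Real.exp_pos _).ne' hZ0pos.ne', Real.log_exp] at hlog
    have hrez : |z.re| ≤ ‖z‖ := Complex.abs_re_le_norm z
    nlinarith [mul_le_mul_of_nonneg_right hrez hNpos.le]
  -- Borel–Carathéodory on `|z| < R`, evaluated on the circle `|z| = r`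
  have hφR : DifferentiableOn ℂ φ (Metric.ball 0 R) := hφdiff.mono (Metric.ball_subset_ball hR.le)
  have hbound : ∀ z ∈ Metric.sphere (0 : ℂ) r, ‖φ z‖ ≤ 2 * R * r / (R - r) := by
    intro z hz
    have hzr : ‖z‖ = r := by simpa using hz
    have hzR : z ∈ Metric.ball (0 : ℂ) R := by
      rw [Metric.mem_ball, dist_zero_right, hzr]; exact hrR
    have h := Complex.borelCaratheodory_zero hR0 hφR hmaps hR0 hzR hφ0
    rwa [hzr] at h
  -- Cauchy's estimate on `|z| ≤ r`
  have hdc : DiffContOnCl ℂ φ (Metric.ball 0 r) :=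
    hφdiff.diffContOnCl_ball (Metric.closedBall_subset_ball (hrR.trans hR))
  have hC : ∀ k : ℕ, ‖iteratedDeriv k φ 0‖ ≤ k.factorial * (2 * R * r / (R - r)) / r ^ k := fun k =>
    Complex.norm_iteratedDeriv_le_of_forall_mem_sphere_norm_le k hr hdc hbound
  refine ⟨fun k => (iteratedDeriv k φ 0).re / k.factorial, fun k => ?_, fun t ht => ?_⟩
  · have hk : (0 : ℝ) < k.factorial := Nat.cast_pos.2 (Nat.factorial_pos k)
    rw [abs_div, Nat.abs_cast, div_le_iff₀ hk]
    calc |(iteratedDeriv k φ 0).re| ≤ ‖iteratedDeriv k φ 0‖ := Complex.abs_re_le_norm _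
      _ ≤ k.factorial * (2 * R * r / (R - r)) / r ^ k := hC k
      _ = 2 * R * r / (R - r) / r ^ k * k.factorial := by ring
  · -- the Taylor series at the real point `t`, real parts
    have htα : |t| < α := ht.trans (hrR.trans hR)
    have htU : ((t : ℝ) : ℂ) ∈ U := by
      simpa [hU, Metric.mem_ball, Complex.norm_real] using htα
    have H := Complex.hasSum_re (Complex.hasSum_taylorSeries_on_ball hφdiff htU)
    have hφre : (φ t).re = freeEnergyIn d Λ β (x + t) - freeEnergyIn d Λ β x := by
      simp only [hφ, Complex.div_ofReal_re, Complex.sub_re]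
      rw [hreL _ htU, hL0, Complex.ofReal_re]
      have hnorm : ‖partitionFunction d Λ β ((x : ℂ) + (t : ℂ))‖ =
          (partitionFunction d Λ β ((x + t : ℝ) : ℂ)).re := by
        rw [← Complex.ofReal_add]
        conv_lhs => rw [partitionFunction_ofReal_eq_re Λ β (x + t)]
        rw [Complex.norm_real, Real.norm_eq_abs, abs_of_pos (partitionFunction_ofReal_re_pos d Λ β _)]
      rw [hnorm, freeEnergyIn, freeEnergyIn, sub_div]
    rw [hφre] at H
    have hfun : (fun n : ℕ => (((n.factorial : ℕ) : ℂ)⁻¹ • ((t : ℂ) - 0) ^ n •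
        iteratedDeriv n φ 0).re) = fun k : ℕ => (iteratedDeriv k φ 0).re / k.factorial * t ^ k := by
      funext n
      rw [sub_zero, smul_eq_mul, smul_eq_mul, ← Complex.ofReal_natCast, ← Complex.ofReal_inv,
        ← Complex.ofReal_pow, ← mul_assoc, ← Complex.ofReal_mul, Complex.re_ofReal_mul]
      ring
    rw [hfun] at H
    exact H

/-! ### Infinite volume: `f_β` is analytic on a disc about every real centre -/

/-- **Analyticity of the free energy about a real centre, below the first Lee–Yang zeros**: for
`β ≥ 0`, real `x` and `0 < r < R < α₁(B_n,β)` for all `n`, `t ↦ f_β(x+t)` extends holomorphically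
to `|z| < r` (compactness of the uniformly bounded coefficient vectors, Tannery, and the existence
of `f_β`, Friedli–Velenik Thm. 3.6). [cite: JiangNewman2023, Thm. 1 (analyticity radius ≥ lim α₁)] -/
theorem exists_ball_extension_freeEnergy {β : ℝ} (hβ : 0 ≤ β) (x : ℝ) {r R : ℝ} (hr : 0 < r)
    (hrR : r < R) (hRα : ∀ n : ℕ, R < firstZero d (box d n) β) :
    ∃ F : ℂ → ℂ, DifferentiableOn ℂ F (Metric.ball 0 r) ∧
      ∀ t : ℝ, |t| < r → F t = JiangNewman.freeEnergy d β (x + t) := by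
  set C : ℝ := 2 * R * r / (R - r) with hC
  have hRr : 0 < R - r := by linarith
  have hR0 : 0 < R := hr.trans hrR
  have hC0 : 0 ≤ C := by rw [hC]; exact div_nonneg (by positivity) hRr.le
  choose e he hsum using fun n : ℕ =>
    exists_taylorCoeff_freeEnergyIn (d := d) hβ (box_nonempty d n) x hr hrR (hRα n)
  -- compactness of the coefficient box and a convergent subsequence
  set K : Set (ℕ → ℝ) := Set.pi Set.univ fun k => Set.Icc (-(C / r ^ k)) (C / r ^ k) with hK
  have hKc : IsCompact K := isCompact_univ_pi fun _ => isCompact_Icc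
  have hxK : ∀ n : ℕ, e n ∈ K := fun n => Set.mem_univ_pi.2 fun k => abs_le.1 (he n k)
  obtain ⟨a, haK, φ, hφ, hlim⟩ := hKc.isSeqCompact hxK
  have hlimk : ∀ k, Tendsto (fun j => e (φ j) k) atTop (𝓝 (a k)) := fun k => by
    have := tendsto_pi_nhds.1 hlim k
    simpa [Function.comp] using this
  have haK' : ∀ k, |a k| ≤ C / r ^ k := fun k => abs_le.2 (Set.mem_univ_pi.1 haK k)
  have hsubseq : Tendsto φ atTop atTop := hφ.tendsto_atTop
  -- the limit series is `f_β(x+t) - f_β(x)` for `|t| < r`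
  have hseries : ∀ t : ℝ, |t| < r →
      HasSum (fun k => a k * t ^ k) (JiangNewman.freeEnergy d β (x + t) - JiangNewman.freeEnergy d β x) := by
    intro t ht
    have hq : |t| / r < 1 := (div_lt_one hr).2 ht
    have hq0 : 0 ≤ |t| / r := by positivity
    have hgeom : Summable (fun k : ℕ => C * (|t| / r) ^ k) :=
      (summable_geometric_of_lt_one hq0 hq).mul_left C
    have hbound_of : ∀ (y : ℝ) (k : ℕ), |y| ≤ C / r ^ k → ‖y * t ^ k‖ ≤ C * (|t| / r) ^ k := by
      intro y k hy
      rw [Real.norm_eq_abs, abs_mul, abs_pow, div_pow]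
      calc |y| * |t| ^ k ≤ C / r ^ k * |t| ^ k := mul_le_mul_of_nonneg_right hy (by positivity)
        _ = C * (|t| ^ k / r ^ k) := by ring
    have hT := tendsto_tsum_of_dominated_convergence (𝓕 := atTop)
      (f := fun j k => e (φ j) k * t ^ k) (g := fun k => a k * t ^ k)
      (bound := fun k => C * (|t| / r) ^ k) hgeom (fun k => (hlimk k).mul_const _)
      (Eventually.of_forall fun j k => hbound_of _ k (he (φ j) k))
    have hfin : ∀ j, ∑' k, e (φ j) k * t ^ k =
        freeEnergyIn d (box d (φ j)) β (x + t) - freeEnergyIn d (box d (φ j)) β x :=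
      fun j => (hsum (φ j) t ht).tsum_eq
    have hconv : Tendsto (fun j => freeEnergyIn d (box d (φ j)) β (x + t) -
        freeEnergyIn d (box d (φ j)) β x) atTop
        (𝓝 (JiangNewman.freeEnergy d β (x + t) - JiangNewman.freeEnergy d β x)) :=
      ((tendsto_freeEnergyIn d β (x + t)).comp hsubseq).sub
        ((tendsto_freeEnergyIn d β x).comp hsubseq)
    have hlim2 := tendsto_nhds_unique (hT.congr hfin) hconv
    have hsumm : Summable (fun k => a k * t ^ k) :=
      hgeom.of_norm_bounded fun k => hbound_of _ k (haK' k)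
    rw [← hlim2]
    exact hsumm.hasSum
  -- the analytic continuation: the power series `∑ aₖ zᵏ` on `|z| < r`
  set A : ℕ → ℂ := fun k => ((a k : ℝ) : ℂ) with hA
  set r' : NNReal := ⟨r, hr.le⟩ with hr'
  set p : FormalMultilinearSeries ℂ ℂ ℂ := FormalMultilinearSeries.ofScalars ℂ A with hp
  have hrad : (r' : ENNReal) ≤ p.radius := by
    refine p.le_radius_of_bound C fun k => ?_
    rw [hp, FormalMultilinearSeries.ofScalars_norm, hA]
    dsimp only
    rw [Complex.norm_real, Real.norm_eq_abs]
    calc |a k| * (r' : ℝ) ^ k ≤ C / r ^ k * r ^ k :=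
        mul_le_mul_of_nonneg_right (haK' k) (by positivity)
      _ = C := by field_simp
  have hr'0 : (0 : NNReal) < r' := by rw [← NNReal.coe_pos]; exact hr
  have hrad0 : 0 < p.radius := lt_of_lt_of_le (ENNReal.coe_pos.2 hr'0) hrad
  have hps := p.hasFPowerSeriesOnBall hrad0
  set P : ℂ → ℂ := p.sum with hP
  have hball : ∀ z : ℂ, z ∈ Metric.ball (0 : ℂ) r → z ∈ Metric.eball (0 : ℂ) p.radius := by
    intro z hz
    refine Metric.eball_subset_eball hrad ?_
    rw [Metric.eball_coe]
    exact hz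
  have hPdiff : DifferentiableOn ℂ P (Metric.ball 0 r) := fun z hz =>
    (hps.analyticAt_of_mem (hball z hz)).differentiableAt.differentiableWithinAt
  have hPreal : ∀ t : ℝ, |t| < r →
      P t = ((JiangNewman.freeEnergy d β (x + t) - JiangNewman.freeEnergy d β x : ℝ) : ℂ) := by
    intro t ht
    have hPz : P t = ∑' k : ℕ, A k • (t : ℂ) ^ k := by
      rw [hP, hp]
      exact FormalMultilinearSeries.ofScalars_sum_eq A _
    have hCx := Complex.hasSum_ofReal.2 (hseries t ht)
    rw [hPz, ← hCx.tsum_eq]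
    refine tsum_congr fun k => ?_
    rw [hA, smul_eq_mul]
    push_cast
    ring
  refine ⟨fun z => P z + ((JiangNewman.freeEnergy d β x : ℝ) : ℂ), hPdiff.add (differentiableOn_const _),
    fun t ht => ?_⟩
  dsimp only
  rw [hPreal t ht]
  push_cast
  ring


/-! ### Gluing local extensions along the real axis into a strip -/

/-- **Gluing**: if a real function `g` has, about every real centre `x`, a holomorphic extension to
the disc `|z - x| < r`, then it has a holomorphic extension to the strip `|Im z| < r` (the local
extensions agree on the overlaps by the identity theorem, the overlaps of two such discs being
convex and meeting the real axis in an interval). [folklore] -/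
theorem exists_strip_extension_of_local {g : ℝ → ℝ} {r : ℝ} (hr : 0 < r)
    (hloc : ∀ x : ℝ, ∃ F : ℂ → ℂ, DifferentiableOn ℂ F (Metric.ball (x : ℂ) r) ∧
      ∀ t : ℝ, |t - x| < r → F t = g t) :
    ∃ F : ℂ → ℂ, DifferentiableOn ℂ F {z : ℂ | |z.im| < r} ∧ ∀ t : ℝ, F t = g t := by
  choose Fx hFx hFxg using hloc
  have hreal_mem : ∀ (a : ℝ) (t : ℝ), ((t : ℂ) ∈ Metric.ball (a : ℂ) r) ↔ |t - a| < r := by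
    intro a t
    rw [Metric.mem_ball, dist_eq_norm, ← Complex.ofReal_sub, Complex.norm_real, Real.norm_eq_abs]
  -- two local extensions with close centres agree on the overlap of their discs
  have key : ∀ a b : ℝ, |a - b| < r →
      Set.EqOn (Fx a) (Fx b) (Metric.ball (a : ℂ) r ∩ Metric.ball (b : ℂ) r) := by
    intro a b hab
    set V : Set ℂ := Metric.ball (a : ℂ) r ∩ Metric.ball (b : ℂ) r with hV
    have hVo : IsOpen V := Metric.isOpen_ball.inter Metric.isOpen_ball
    have hVc : IsPreconnected V := ((convex_ball _ _).inter (convex_ball _ _)).isPreconnected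
    have hbV : ((b : ℝ) : ℂ) ∈ V := by
      refine ⟨(hreal_mem a b).2 (by rwa [abs_sub_comm]), Metric.mem_ball_self hr⟩
    have hfa : AnalyticOnNhd ℂ (Fx a) V :=
      ((hFx a).analyticOnNhd Metric.isOpen_ball).mono Set.inter_subset_left
    have hfb : AnalyticOnNhd ℂ (Fx b) V :=
      ((hFx b).analyticOnNhd Metric.isOpen_ball).mono Set.inter_subset_right
    refine hfa.eqOn_of_preconnected_of_frequently_eq hfb hVc hbV ?_
    have htend : Tendsto (fun t : ℝ => (t : ℂ)) (𝓝[≠] b) (𝓝[≠] ((b : ℝ) : ℂ)) := by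
      refine tendsto_nhdsWithin_of_tendsto_nhds_of_eventually_within _
        (Complex.continuous_ofReal.continuousAt.mono_left nhdsWithin_le_nhds) ?_
      refine eventually_nhdsWithin_of_forall fun t ht => ?_
      simpa using ht
    refine htend.frequently ?_
    have h1 : ∀ᶠ t : ℝ in 𝓝 b, ((t : ℝ) : ℂ) ∈ V :=
      Complex.continuous_ofReal.continuousAt.eventually_mem (hVo.mem_nhds hbV)
    have hev : ∀ᶠ t : ℝ in 𝓝[≠] b, Fx a t = Fx b t := by
      refine (h1.filter_mono nhdsWithin_le_nhds).mono fun t ht => ?_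
      rw [hFxg a t ((hreal_mem a t).1 ht.1), hFxg b t ((hreal_mem b t).1 ht.2)]
    exact hev.frequently
  refine ⟨fun z => Fx z.re z, fun z₀ hz₀ => ?_, fun t => ?_⟩
  · have hz₀' : |z₀.im| < r := hz₀
    have hmem_self : ∀ z : ℂ, |z.im| < r → z ∈ Metric.ball ((z.re : ℝ) : ℂ) r := by
      intro z hz
      rw [Metric.mem_ball, dist_eq_norm]
      have : z - ((z.re : ℝ) : ℂ) = (z.im : ℂ) * I := by
        apply Complex.ext <;> simp
      rw [this, norm_mul, Complex.norm_I, mul_one, Complex.norm_real, Real.norm_eq_abs]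
      exact hz
    have c1 : ∀ᶠ z : ℂ in 𝓝 z₀, |z.im| < r :=
      (isOpen_lt (continuous_abs.comp Complex.continuous_im) continuous_const).mem_nhds hz₀'
    have c2 : ∀ᶠ z : ℂ in 𝓝 z₀, z ∈ Metric.ball ((z₀.re : ℝ) : ℂ) r :=
      Metric.isOpen_ball.mem_nhds (hmem_self z₀ hz₀')
    have c3 : ∀ᶠ z : ℂ in 𝓝 z₀, |z.re - z₀.re| < r := by
      have hc : Continuous fun z : ℂ => |z.re - z₀.re| := by fun_prop
      have := (isOpen_lt hc continuous_const).mem_nhds (show |z₀.re - z₀.re| < r by simpa using hr)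
      exact this
    have hnear : ∀ᶠ z : ℂ in 𝓝 z₀, Fx z.re z = Fx z₀.re z := by
      filter_upwards [c1, c2, c3] with z h1 h2 h3
      exact key z.re z₀.re h3 ⟨hmem_self z h1, h2⟩
    have hdiff₀ : DifferentiableAt ℂ (Fx z₀.re) z₀ :=
      (hFx z₀.re).differentiableAt (Metric.isOpen_ball.mem_nhds (hmem_self z₀ hz₀'))
    exact (hdiff₀.congr_of_eventuallyEq hnear).differentiableWithinAt
  · show Fx ((t : ℂ).re) t = g t
    rw [Complex.ofReal_re]
    exact hFxg t t (by simpa using hr)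

/-- **The free energy extends holomorphically to a strip**: for `β ≥ 0` and `0 < w ≤ α₁(B_n, β)` for
all `n`, `f_β` extends holomorphically to `{|Im z| < w/2}`. [cite: JiangNewman2023, Thm. 1 with §2 eq. (2.4)] -/
theorem exists_strip_extension_freeEnergy {β : ℝ} (hβ : 0 ≤ β) {w : ℝ} (hw : 0 < w)
    (hwα : ∀ n : ℕ, w ≤ firstZero d (box d n) β) :
    ∃ F : ℂ → ℂ, DifferentiableOn ℂ F {z : ℂ | |z.im| < w / 2} ∧
      ∀ t : ℝ, F t = JiangNewman.freeEnergy d β t := by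
  refine exists_strip_extension_of_local (half_pos hw) fun x => ?_
  obtain ⟨F, hF, hFt⟩ := exists_ball_extension_freeEnergy (d := d) hβ x (half_pos hw)
    (show w / 2 < 3 * w / 4 by linarith) (fun n => by linarith [hwα n])
  refine ⟨fun z => F (z - x), hF.comp (differentiableOn_id.sub (differentiableOn_const _))
    fun z hz => ?_, fun t ht => ?_⟩
  · simpa [Metric.mem_ball, dist_eq_norm] using hz
  · have h := hFt (t - x) ht
    dsimp only
    rw [← Complex.ofReal_sub, h, add_sub_cancel]

/-! ### The derivative of the free energy is the magnetisation -/

/-- **Upper convexity bracket in infinite volume**: for `β > 0` and `0 ≤ h₁ ≤ h₂`,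
`f_β(h₂) - f_β(h₁) ≤ (h₂ - h₁) ⟨σ₀⟩^∅_{β,h₂/β}` (finite volume: `log_isingPartitionFunction_sub_mem`;
the free state dominates its boxes and is translation invariant). [cite: FriedliVelenik2017, §3.7, Prop. 3.29 and its proof] -/
theorem freeEnergy_sub_le_mul_freeCorr {β : ℝ} (hβ : 0 < β) {h₁ h₂ : ℝ} (hh₁ : 0 ≤ h₁)
    (hh : h₁ ≤ h₂) :
    JiangNewman.freeEnergy d β h₂ - JiangNewman.freeEnergy d β h₁ ≤
      (h₂ - h₁) * freeCorr d β (h₂ / β) {0} := by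
  have hβ0 : β ≠ 0 := hβ.ne'
  have hh₂β : 0 ≤ h₂ / β := div_nonneg (hh₁.trans hh) hβ.le
  have hfin : ∀ n : ℕ, freeEnergyIn d (box d n) β h₂ - freeEnergyIn d (box d n) β h₁ ≤
      (h₂ - h₁) * freeCorr d β (h₂ / β) {0} := by
    intro n
    have hN : (0 : ℝ) < #(box d n) := Nat.cast_pos.2 (Finset.card_pos.2 (box_nonempty d n))
    have h2 := (log_isingPartitionFunction_sub_mem (zdGraph d) (box d n) hβ.le
      (div_nonneg hh₁ hβ.le) (div_le_div_of_nonneg_right hh hβ.le) (bc := .free) (Or.inl rfl)).2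
    have hone : ∀ x ∈ box d n,
        isingCorr (zdGraph d) (box d n) β (h₂ / β) .free {x} ≤ freeCorr d β (h₂ / β) {0} := by
      intro x hx
      have h1 := isingCorr_free_box_le_freeCorr (d := d) hβ.le hh₂β (A := {x}) (L := n)
        (Finset.singleton_subset_iff.2 hx)
      have h0 : ({0} : Finset (Site d)).map (Site.shift x).toEmbedding = {x} := by
        rw [Finset.map_singleton]
        simp
      have h3 := freeCorr_shift d hβ.le hh₂β x {0}
      rw [h0] at h3
      rw [← h3]
      exact h1
    have hsum : ∑ x ∈ box d n, isingCorr (zdGraph d) (box d n) β (h₂ / β) .free {x} ≤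
        #(box d n) * freeCorr d β (h₂ / β) {0} := by
      calc ∑ x ∈ box d n, isingCorr (zdGraph d) (box d n) β (h₂ / β) .free {x}
          ≤ ∑ x ∈ box d n, freeCorr d β (h₂ / β) {0} := Finset.sum_le_sum hone
        _ = #(box d n) * freeCorr d β (h₂ / β) {0} := by rw [Finset.sum_const, nsmul_eq_mul]
    rw [freeEnergyIn_eq_pressureIn d hβ0, freeEnergyIn_eq_pressureIn d hβ0, pressureIn, pressureIn,
      ← sub_div, div_le_iff₀ hN]
    have hββ : β * (h₂ / β - h₁ / β) = h₂ - h₁ := by field_simp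
    rw [hββ] at h2
    calc Real.log (isingPartitionFunction (zdGraph d) (box d n) β (h₂ / β) .free) -
          Real.log (isingPartitionFunction (zdGraph d) (box d n) β (h₁ / β) .free)
        ≤ (h₂ - h₁) * ∑ x ∈ box d n, isingCorr (zdGraph d) (box d n) β (h₂ / β) .free {x} := h2
      _ ≤ (h₂ - h₁) * (#(box d n) * freeCorr d β (h₂ / β) {0}) :=
          mul_le_mul_of_nonneg_left hsum (sub_nonneg.2 hh)
      _ = (h₂ - h₁) * freeCorr d β (h₂ / β) {0} * #(box d n) := by ring
  exact le_of_tendsto_of_tendsto' ((tendsto_freeEnergyIn d β h₂).sub (tendsto_freeEnergyIn d β h₁))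
    tendsto_const_nhds hfin

/-- **Lower convexity bracket in infinite volume**: for `β > 0` and `0 ≤ h₁ < h₂`,
`(h₂ - h₁) ⟨σ₀⟩^∅_{β,h₁/β} ≤ f_β(h₂) - f_β(h₁)` (`mul_isingCorr_le_freeEnergy_sub` in the box
limit). [cite: FriedliVelenik2017, §3.7, Prop. 3.29 and its proof] -/
theorem mul_freeCorr_le_freeEnergy_sub {β : ℝ} (hβ : 0 < β) {h₁ h₂ : ℝ} (hh₁ : 0 ≤ h₁)
    (hh : h₁ < h₂) :
    (h₂ - h₁) * freeCorr d β (h₁ / β) {0} ≤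
      JiangNewman.freeEnergy d β h₂ - JiangNewman.freeEnergy d β h₁ := by
  have hlim : Tendsto (fun m : ℕ => isingCorr (zdGraph d) (box d m) β (h₁ / β) .free {0}) atTop
      (𝓝 (freeCorr d β (h₁ / β) {0})) :=
    hasBoxLimit_isingCorr_free_holds (d := d) hβ.le (div_nonneg hh₁ hβ.le) {0}
  exact le_of_tendsto' (hlim.const_mul (h₂ - h₁)) fun m =>
    mul_isingCorr_le_freeEnergy_sub d hβ hh₁ hh m

/-- **`f_β'(h) = ⟨σ₀⟩^∅_{β,h/β}` at `h > 0`** whenever `f_β` is differentiable there (the two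
convexity brackets squeeze the one-sided difference quotients). [cite: FriedliVelenik2017, Prop. 3.29 with Thm. 3.34] -/
theorem deriv_freeEnergy_eq_freeCorr {β : ℝ} (hβ : 0 < β) {t D : ℝ} (ht : 0 < t)
    (hD : HasDerivAt (JiangNewman.freeEnergy d β) D t) : D = freeCorr d β (t / β) {0} := by
  have hslope : Tendsto (slope (JiangNewman.freeEnergy d β) t) (𝓝[≠] t) (𝓝 D) :=
    hasDerivAt_iff_tendsto_slope.1 hD
  refine le_antisymm ?_ ?_
  · have h1 : Tendsto (slope (JiangNewman.freeEnergy d β) t) (𝓝[<] t) (𝓝 D) :=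
      hslope.mono_left (nhdsWithin_mono _ fun s hs => ne_of_lt hs)
    refine le_of_tendsto h1 ?_
    filter_upwards [Ioo_mem_nhdsLT ht] with s hs
    rw [slope_def_field]
    have hle := freeEnergy_sub_le_mul_freeCorr (d := d) hβ hs.1.le hs.2.le
    rw [div_le_iff_of_neg (sub_neg.2 hs.2)]
    nlinarith
  · have h1 : Tendsto (slope (JiangNewman.freeEnergy d β) t) (𝓝[>] t) (𝓝 D) :=
      hslope.mono_left (nhdsWithin_mono _ fun s hs => ne_of_gt hs)
    refine ge_of_tendsto h1 ?_
    filter_upwards [self_mem_nhdsWithin] with s hs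
    have hs' : t < s := hs
    rw [slope_def_field, le_div_iff₀ (sub_pos.2 hs')]
    have := mul_freeCorr_le_freeEnergy_sub (d := d) hβ ht.le hs'
    linarith

/-- **`f_β'(0) = 0`** whenever `f_β` is differentiable at `0` (evenness, `freeEnergy_neg`). [cite: JiangNewman2023, §2 (b_k = 0 for odd k)] -/
theorem deriv_freeEnergy_zero {β : ℝ} (hβ : β ≠ 0) {D : ℝ}
    (hD : HasDerivAt (JiangNewman.freeEnergy d β) D 0) : D = 0 := by
  have h1 : HasDerivAt (fun s : ℝ => JiangNewman.freeEnergy d β (-s)) (D * -1) 0 := by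
    have hD' : HasDerivAt (JiangNewman.freeEnergy d β) D (-0) := by rwa [neg_zero]
    exact hD'.comp (0 : ℝ) (hasDerivAt_neg (0 : ℝ))
  have hfun : (fun s : ℝ => JiangNewman.freeEnergy d β (-s)) = JiangNewman.freeEnergy d β :=
    funext fun s => freeEnergy_neg d hβ s
  rw [hfun] at h1
  have := hD.unique h1
  linarith

/-! ### The magnetisation in a strip -/

/-- **The magnetisation extends holomorphically to a strip below the first Lee–Yang zeros**
(`d ≥ 1`, `β > 0` with `m*(β) = 0`): if `0 < w ≤ α₁(B_n,β)` for all `n` and `βθ ≤ w/2`, there is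
`F` holomorphic on `{|Im z| < θ}` with `F(h) = m(β,h) = ⟨σ₀⟩⁺_{β,h}` for all real `h ≥ 0`, namely
`F(z) = f_β'(βz)` (`m(β,h) = ∂f_β/∂h (βh)` for `h > 0`, and `= 0 = m*(β)` at `h = 0`).
[cite: FriedliVelenik2017, Prop. 3.29 with Thm. 3.34 and Thm. 3.25 (1)] -/
theorem exists_strip_extension_magnetization (hd : 1 ≤ d) {β : ℝ} (hβ : 0 < β)
    (hm : spontaneousMagnetization d β = 0) {w : ℝ} (hw : 0 < w)
    (hwα : ∀ n : ℕ, w ≤ firstZero d (box d n) β) {θ : ℝ} (hθ : β * θ ≤ w / 2) :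
    ∃ F : ℂ → ℂ, DifferentiableOn ℂ F {z : ℂ | |z.im| < θ} ∧
      ∀ h : ℝ, 0 ≤ h → F (h : ℂ) = ((magnetizationInField d β h : ℝ) : ℂ) := by
  obtain ⟨F, hF, hFt⟩ := exists_strip_extension_freeEnergy (d := d) hβ.le hw hwα
  set S : Set ℂ := {z : ℂ | |z.im| < w / 2} with hS
  have hSo : IsOpen S := isOpen_lt (continuous_abs.comp Complex.continuous_im) continuous_const
  set G : ℂ → ℂ := deriv F with hG
  have hGdiff : DifferentiableOn ℂ G S := hF.deriv hSo
  have hmemS : ∀ t : ℝ, ((t : ℝ) : ℂ) ∈ S := fun t => by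
    show |((t : ℝ) : ℂ).im| < w / 2
    rw [Complex.ofReal_im, abs_zero]; exact half_pos hw
  -- the real derivative of `f_β` is `Re G`, and `G` is real on the real axis
  have hreal : ∀ t : ℝ, HasDerivAt (JiangNewman.freeEnergy d β) (G t).re t ∧
      G t = (((G t).re : ℝ) : ℂ) := by
    intro t
    have hFd : HasDerivAt F (G t) (t : ℂ) :=
      (hF.differentiableAt (hSo.mem_nhds (hmemS t))).hasDerivAt
    have h1 : HasDerivAt (fun s : ℝ => (F s).re) (G t).re t := hFd.real_of_complex
    have hfun : (fun s : ℝ => (F s).re) = JiangNewman.freeEnergy d β := by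
      funext s; rw [hFt s, Complex.ofReal_re]
    rw [hfun] at h1
    refine ⟨h1, ?_⟩
    have h2 : HasDerivAt (fun s : ℝ => F s) (G t) t := hFd.comp_ofReal
    have h3 : HasDerivAt (fun s : ℝ => ((JiangNewman.freeEnergy d β s : ℝ) : ℂ))
        ((((G t).re : ℝ)) : ℂ) t := h1.ofReal_comp
    have hfun2 : (fun s : ℝ => F s) = fun s : ℝ => ((JiangNewman.freeEnergy d β s : ℝ) : ℂ) :=
      funext fun s => hFt s
    rw [hfun2] at h2
    exact h2.unique h3
  have hGt : ∀ t : ℝ, 0 < t → G t = ((freeCorr d β (t / β) {0} : ℝ) : ℂ) := by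
    intro t ht
    rw [(hreal t).2, deriv_freeEnergy_eq_freeCorr (d := d) hβ ht (hreal t).1]
  have hG0 : G 0 = 0 := by
    have hz : (G ((0 : ℝ) : ℂ)).re = 0 := deriv_freeEnergy_zero (d := d) hβ.ne' (hreal 0).1
    have h := (hreal 0).2
    rw [hz] at h
    simpa using h
  refine ⟨fun z => G ((β : ℂ) * z), ?_, ?_⟩
  · refine hGdiff.comp ((differentiableOn_const _).mul differentiableOn_id) fun z hz => ?_
    have hz' : |z.im| < θ := hz
    show |(((β : ℂ) * z)).im| < w / 2
    rw [Complex.mul_im, Complex.ofReal_re, Complex.ofReal_im, zero_mul, add_zero, abs_mul,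
      abs_of_pos hβ]
    calc β * |z.im| < β * θ := mul_lt_mul_of_pos_left hz' hβ
      _ ≤ w / 2 := hθ
  · intro h hh
    dsimp only
    rcases hh.eq_or_lt with h0 | hpos
    · rw [← h0, Complex.ofReal_zero, mul_zero, hG0, magnetizationInField_zero, hm,
        Complex.ofReal_zero]
    · have hcast : ((β : ℂ) * (h : ℂ)) = ((β * h : ℝ) : ℂ) := by push_cast; ring
      rw [hcast, hGt (β * h) (mul_pos hβ hpos), mul_div_cancel_left₀ h hβ.ne',
        freeCorr_eq_plusCorr_singleton_of_pos_holds (d := d) hd hβ.le hpos]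
      congr 1
      rw [magnetizationInField, plusCorr]
      congr 1
      funext s
      simp [spinProduct]

end JiangNewman

end Literature.Probability.LatticeModels

end
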